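import Mathlib
import HarnessLib
import Literature.NumberTheory.LFunctions.RiemannXi
import Literature.NumberTheory.LFunctions.RiemannXiLogDeriv
import Literature.NumberTheory.LFunctions.RiemannXiHadamardProduct
import Literature.NumberTheory.LFunctions.DeBruijnHLogDerivSeries
import Literature.NumberTheory.LFunctions.XiHorizontalLogDeriv
import Summits.RiemannHypothesis.RiemannHypothesis.Theses.DeBrangesSuzukiDoor
import Summits.RiemannHypothesis.RiemannHypothesis.Theorems.DeBrangesSuzukiDoorDefs
import Summits.RiemannHypothesis.RiemannHypothesis.Theorems.DeBrangesSuzukiDoorSymbolRigidity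
import Summits.RiemannHypothesis.RiemannHypothesis.Theorems.DeBrangesSuzukiDoorLaplaceWindow
import Summits.RiemannHypothesis.RiemannHypothesis.Theorems.DeBrangesSuzukiDoorKernelSupportSymbolDecayUniform
import Literature.NumberTheory.LFunctions.SuzukiSingleOperatorKernelProofs

/-!
# RiemannHypothesis / DeBrangesSuzukiDoor — H1 assembly, K1/K2 regularity, support item `DoorModuloKernel`

Port of §WitnessQuotient (assembly), §LineIntegrable and §LineIntegrableLargeTheta of the rh-dbr
scratch module `SuzukiCanonicalWindow.lean` (sha16 `82bfcc5f80debbaf`; referee read PASS 2026-08-25T19:28Z), and the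
closing theorem `doorModuloKernel_proof : Theses.DeBrangesSuzukiDoor.DoorModuloKernel` (route
`route-RiemannHypothesis-DeBrangesSuzukiDoor`, support item stmt-RiemannHypothesis-19729). H1+H2:
`rh_of_limTemperedWitness_on` (kernel package on `Im z > c`, `c ≥ 1/2`, and `W_θ ∈ L²` ⟹ RH via
`rh_of_symbolQuotientOn`); K2: continuity and `|K_θ(x)| ≤ (‖Θ_θ(·+i)‖₁/2π)eˣ` from K1; K1 (`θ > 10`):
`Θ_θ(·+i) ∈ L¹` from the RH-free Hadamard sum and the horizontal model `norm_logDeriv_riemannXi_sub_model_le'`.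
All hypotheses are explicit binders; the route decl's `let Θ`/`let K` are `limTheta θ`/`limKernel θ` by `rfl`.
RH-FREE implication about an RH-EQUIVALENT·DERIVED criterion; nothing here bears on the truth of RH.
-/

noncomputable section

-- D-0017: `Summit.<S>.<S>.…` is the designed namespace of a single-problem summit.
set_option linter.dupNamespace false

open MeasureTheory Complex
open Filter Topology Set
open scoped ComplexConjugate

namespace Summit.RiemannHypothesis.RiemannHypothesis.Theorems.SuzukiDoor

open Literature.NumberTheory.LFunctions

/-- CORE (PROVED, RH-FREE): a square-integrable window average gives a holomorphic quotient representation of `Θ_θ` on the half-plane `Im z > c` where the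
kernel facts hold: `G(z) = ∫ W_θ(u) e^{izu} du` (holomorphic on `ℂ₊` since `W_θ ∈ L²` vanishes on `(-∞,-1]`), `F = unitLaplace` (holomorphic, `F(i) ≠ 0`),
`Θ_θ F = G` by Fubini and the Laplace identity. -/
theorem quotient_of_witness_on {θ c : ℝ} (hc : 0 ≤ c) (hKc : Continuous (limKernel θ))
    (hK0 : ∀ x : ℝ, x < 0 → limKernel θ x = 0) {C : ℝ}
    (hC : ∀ x : ℝ, 0 ≤ x → |limKernel θ x| ≤ C * Real.exp (c * x))
    (hLap : ∀ z : ℂ, c < z.im →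
      IntegrableOn (fun x : ℝ => (limKernel θ x : ℂ) * Complex.exp (I * z * (x : ℂ))) (Set.Ioi 0) ∧
        ∫ x in Set.Ioi (0 : ℝ), (limKernel θ x : ℂ) * Complex.exp (I * z * (x : ℂ)) = limTheta θ z)
    (hW : MemLp (limWindowAvg θ) 2 volume) :
    ∃ G F : ℂ → ℂ, DifferentiableOn ℂ G {z : ℂ | 0 < z.im} ∧ DifferentiableOn ℂ F {z : ℂ | 0 < z.im} ∧
      (∃ z : ℂ, 0 < z.im ∧ F z ≠ 0) ∧ ∀ z : ℂ, c < z.im → limTheta θ z * F z = G z := by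
  have hW0 : ∀ u : ℝ, u ≤ -1 → limWindowAvg θ u = 0 := fun u hu => window_eq_zero_of_le hK0 hu
  refine ⟨fun z => ∫ u : ℝ, (limWindowAvg θ u : ℂ) * Complex.exp (I * z * (u : ℂ)), unitLaplace,
    differentiableOn_laplace_of_memLp hW hW0, differentiableOn_unitLaplace,
    ⟨I, by simp, unitLaplace_I_ne_zero⟩, fun z hz => ?_⟩
  have h := laplace_window_eq hKc hK0 hc hC hz
  show limTheta θ z * unitLaplace z =
    ∫ u : ℝ, ((∫ y in Set.Ioo (0 : ℝ) 1, limKernel θ (u + y) : ℝ) : ℂ) * Complex.exp (I * z * (u : ℂ))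
  rw [h, (hLap z hz).2]
/-- ASSEMBLED (RH-FREE theorem about the criterion, modulo the ONE kernel hypothesis `LimKernelBasicOn θ c` for ANY `c ≥ 1/2` — e.g. `c = 1`, inside the
half-plane of absolute convergence): square-integrability of the single explicit function `W_θ` implies RH. Nothing here bears on the truth of RH: it is one
direction of an RH-EQUIVALENT·DERIVED criterion. -/
theorem rh_of_limTemperedWitness_on {θ c : ℝ} (hθ : θ ≠ 0) (hc : 1 / 2 ≤ c)
    (hKc : Continuous (limKernel θ)) (hK0 : ∀ x : ℝ, x < 0 → limKernel θ x = 0) {C : ℝ}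
    (hC : ∀ x : ℝ, 0 ≤ x → |limKernel θ x| ≤ C * Real.exp (c * x))
    (hLap : ∀ z : ℂ, c < z.im →
      IntegrableOn (fun x : ℝ => (limKernel θ x : ℂ) * Complex.exp (I * z * (x : ℂ))) (Set.Ioi 0) ∧
        ∫ x in Set.Ioi (0 : ℝ), (limKernel θ x : ℂ) * Complex.exp (I * z * (x : ℂ)) = limTheta θ z)
    (hW : MemLp (limWindowAvg θ) 2 volume) : _root_.RiemannHypothesis := by
  obtain ⟨G, F, hG, hF, hF0, hGF⟩ := quotient_of_witness_on (by linarith) hKc hK0 hC hLap hW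
  exact rh_of_symbolQuotientOn hθ hc hG hF hF0 hGF
/-- Continuity in `x` of `Re (1/2π) ∫ Φ(u+ic) e^{-i(u+ic)x} du` when the integrand is integrable for every `x` (dominated convergence, dominating function
`‖Φ(u+ic)‖ e^{c(x₀+1)}` near `x₀`, `c ≥ 0`). -/
theorem continuous_lineTransform_re {Φ : ℂ → ℂ} {c : ℝ} (hc : 0 ≤ c)
    (hInt : ∀ x : ℝ, Integrable (fun u : ℝ => Φ ((u : ℂ) + (c : ℂ) * I) *
      Complex.exp (-I * ((u : ℂ) + (c : ℂ) * I) * (x : ℂ)))) :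
    Continuous (fun x : ℝ => ((1 : ℂ) / (2 * (Real.pi : ℂ)) * ∫ u : ℝ, Φ ((u : ℂ) + (c : ℂ) * I) *
      Complex.exp (-I * ((u : ℂ) + (c : ℂ) * I) * (x : ℂ))).re) := by
  have hre : ∀ u x : ℝ, (-I * ((u : ℂ) + (c : ℂ) * I) * (x : ℂ)).re = c * x := by
    intro u x
    simp [Complex.mul_re, Complex.mul_im]
  have hcont : Continuous (fun x : ℝ => ∫ u : ℝ, Φ ((u : ℂ) + (c : ℂ) * I) *
      Complex.exp (-I * ((u : ℂ) + (c : ℂ) * I) * (x : ℂ))) := by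
    refine continuous_iff_continuousAt.2 fun x₀ => ?_
    refine continuousAt_of_dominated
      (bound := fun u => ‖Φ ((u : ℂ) + (c : ℂ) * I)‖ * Real.exp (c * (x₀ + 1))) ?_ ?_ ?_ ?_
    · exact Filter.Eventually.of_forall fun x => (hInt x).aestronglyMeasurable
    · have hnhds : Set.Iio (x₀ + 1) ∈ nhds x₀ := Iio_mem_nhds (by linarith)
      filter_upwards [hnhds] with x hx
      refine Filter.Eventually.of_forall fun u => ?_
      rw [norm_mul, Complex.norm_exp, hre]
      exact mul_le_mul_of_nonneg_left
        (Real.exp_le_exp.2 (mul_le_mul_of_nonneg_left (le_of_lt (Set.mem_Iio.mp hx)) hc)) (norm_nonneg _)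
    · have h0 : Integrable (fun u : ℝ => ‖Φ ((u : ℂ) + (c : ℂ) * I)‖) := by
        have h := (hInt 0).norm
        simpa using h
      exact h0.mul_const _
    · refine Filter.Eventually.of_forall fun u => ?_
      have h : Continuous fun x : ℝ => Φ ((u : ℂ) + (c : ℂ) * I) *
          Complex.exp (-I * ((u : ℂ) + (c : ℂ) * I) * (x : ℂ)) :=
        continuous_const.mul (Complex.continuous_exp.comp (continuous_const.mul Complex.continuous_ofReal))
      exact h.continuousAt
  exact Complex.continuous_re.comp (continuous_const.mul hcont)
/-- `Re (-i(u+ic)x) = c x`. -/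
lemma re_neg_I_line (c x u : ℝ) : (-I * ((u : ℂ) + (c : ℂ) * I) * (x : ℂ)).re = c * x := by
  simp only [Complex.mul_re, Complex.mul_im, Complex.neg_re, Complex.neg_im, Complex.add_re,
    Complex.add_im, Complex.I_re, Complex.I_im, Complex.ofReal_re, Complex.ofReal_im]
  ring
/-- `|e^{-i(u+ic)x}| = e^{cx}`. -/
lemma norm_cexp_line (c x u : ℝ) :
    ‖Complex.exp (-I * ((u : ℂ) + (c : ℂ) * I) * (x : ℂ))‖ = Real.exp (c * x) := by
  rw [Complex.norm_exp, re_neg_I_line]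
/-- Integrability of the line integrand for every `x` from integrability of the symbol on the line. -/
lemma integrable_lineIntegrand_of_integrable {Φ : ℂ → ℂ} {c : ℝ}
    (hI : Integrable (fun u : ℝ => Φ ((u : ℂ) + (c : ℂ) * I))) (x : ℝ) :
    Integrable (fun u : ℝ => Φ ((u : ℂ) + (c : ℂ) * I) *
      Complex.exp (-I * ((u : ℂ) + (c : ℂ) * I) * (x : ℂ))) := by
  refine (hI.norm.mul_const (Real.exp (c * x))).mono' ?_ (Filter.Eventually.of_forall fun u => ?_)
  · exact hI.1.mul (by fun_prop : Continuous fun u : ℝ =>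
      Complex.exp (-I * ((u : ℂ) + (c : ℂ) * I) * (x : ℂ))).aestronglyMeasurable
  · rw [norm_mul, norm_cexp_line]
/-- `‖(1/2π) ∫ Φ(u+ic) e^{-i(u+ic)x} du‖ ≤ (1/2π) e^{cx} ‖Φ(·+ic)‖₁` (unconditional: both sides are junk-compatible; meaningful when `Φ(·+ic)` is integrable).
-/
lemma norm_lineTransform_le (Φ : ℂ → ℂ) (c x : ℝ) :
    ‖(1 : ℂ) / (2 * (Real.pi : ℂ)) * ∫ u : ℝ, Φ ((u : ℂ) + (c : ℂ) * I) *
        Complex.exp (-I * ((u : ℂ) + (c : ℂ) * I) * (x : ℂ))‖ ≤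
      1 / (2 * Real.pi) * Real.exp (c * x) * ∫ u : ℝ, ‖Φ ((u : ℂ) + (c : ℂ) * I)‖ := by
  have hn : ‖(1 : ℂ) / (2 * (Real.pi : ℂ))‖ = 1 / (2 * Real.pi) := by
    rw [norm_div, norm_mul, norm_one, Complex.norm_real, Complex.norm_two, Real.norm_eq_abs,
      abs_of_pos Real.pi_pos]
  rw [norm_mul, hn]
  have h1 : ‖∫ u : ℝ, Φ ((u : ℂ) + (c : ℂ) * I) * Complex.exp (-I * ((u : ℂ) + (c : ℂ) * I) * (x : ℂ))‖
      ≤ ∫ u : ℝ, ‖Φ ((u : ℂ) + (c : ℂ) * I)‖ * Real.exp (c * x) := by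
    refine (norm_integral_le_integral_norm _).trans (le_of_eq ?_)
    congr 1
    funext u
    rw [norm_mul, norm_cexp_line]
  rw [integral_mul_const] at h1
  have hπ : 0 ≤ 1 / (2 * Real.pi) := by positivity
  calc 1 / (2 * Real.pi) *
        ‖∫ u : ℝ, Φ ((u : ℂ) + (c : ℂ) * I) * Complex.exp (-I * ((u : ℂ) + (c : ℂ) * I) * (x : ℂ))‖
      ≤ 1 / (2 * Real.pi) * ((∫ u : ℝ, ‖Φ ((u : ℂ) + (c : ℂ) * I)‖) * Real.exp (c * x)) := by
        gcongr
    _ = 1 / (2 * Real.pi) * Real.exp (c * x) * ∫ u : ℝ, ‖Φ ((u : ℂ) + (c : ℂ) * I)‖ := by ring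

/-- K2 (PROVED, RH-FREE): continuity of `K_θ` from K1 (integrability of `Θ_θ(· + i)` on the defining line). -/
theorem continuous_limKernel_of_lineIntegrable {θ : ℝ}
    (hI : Integrable (fun u : ℝ => limTheta θ ((u : ℂ) + ((1 : ℝ) : ℂ) * I))) :
    Continuous (limKernel θ) := by
  have h : limKernel θ = fun x : ℝ => ((1 : ℂ) / (2 * (Real.pi : ℂ)) *
      ∫ u : ℝ, limTheta θ ((u : ℂ) + ((1 : ℝ) : ℂ) * I) *
        Complex.exp (-I * ((u : ℂ) + ((1 : ℝ) : ℂ) * I) * (x : ℂ))).re := by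
    funext x; rfl
  rw [h]
  exact continuous_lineTransform_re zero_le_one (integrable_lineIntegrand_of_integrable hI)

/-- K2 (PROVED, RH-FREE): the growth bound `|K_θ(x)| ≤ (‖Θ_θ(·+i)‖₁/2π) e^{x}` for ALL real `x` (unconditional as typed — junk-compatible — and meaningful
under K1). -/
theorem abs_limKernel_le_exp (θ x : ℝ) :
    |limKernel θ x| ≤
      (1 / (2 * Real.pi) * ∫ u : ℝ, ‖limTheta θ ((u : ℂ) + ((1 : ℝ) : ℂ) * I)‖) * Real.exp (1 * x) := by
  have h := norm_lineTransform_le (limTheta θ) 1 x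
  have h2 := Complex.abs_re_le_norm (((1 : ℂ) / (2 * (Real.pi : ℂ))) *
    ∫ u : ℝ, limTheta θ ((u : ℂ) + ((1 : ℝ) : ℂ) * I) *
      Complex.exp (-I * ((u : ℂ) + ((1 : ℝ) : ℂ) * I) * (x : ℂ)))
  calc |limKernel θ x| ≤ _ := h2
    _ ≤ _ := h
    _ = _ := by ring

/-- ASSEMBLED (RH-FREE): `W_θ ∈ L² ⟹ RH` modulo K1 (line integrability), K3, K4 — all three RH-free classical statements about the single kernel. Nothing here
bears on the truth of RH. -/
theorem rh_of_limTemperedWitness_of_K134 {θ : ℝ} (hθ : θ ≠ 0)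
    (hI : Integrable (fun u : ℝ => limTheta θ ((u : ℂ) + ((1 : ℝ) : ℂ) * I)))
    (h0 : ∀ x : ℝ, x < 0 → limKernel θ x = 0)
    (hLap : ∀ z : ℂ, 1 < z.im →
      IntegrableOn (fun x : ℝ => (limKernel θ x : ℂ) * Complex.exp (I * z * (x : ℂ))) (Set.Ioi 0) ∧
        ∫ x in Set.Ioi (0 : ℝ), (limKernel θ x : ℂ) * Complex.exp (I * z * (x : ℂ)) = limTheta θ z)
    (hW : MemLp (limWindowAvg θ) 2 volume) : _root_.RiemannHypothesis :=
  rh_of_limTemperedWitness_on hθ (by norm_num) (continuous_limKernel_of_lineIntegrable hI) h0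
    (fun x _ => abs_limKernel_le_exp θ x) hLap hW

open Literature.NumberTheory.LFunctions

/-- Pure inequality behind the comparison of abscissae: for `0 < β < 1`, `(5-β)/((5-β)²+τ²) ≤ 10·(3/2-β)/((3/2-β)²+τ²)`. -/
theorem hadamardTerm_compare {β : ℝ} (h0 : 0 < β) (h1 : β < 1) (τ : ℝ) :
    (5 - β) / ((5 - β) ^ 2 + τ ^ 2) ≤ 10 * ((3 / 2 - β) / ((3 / 2 - β) ^ 2 + τ ^ 2)) := by
  have ha : 0 < 3 / 2 - β := by linarith
  have hd1 : 0 < (3 / 2 - β) ^ 2 + τ ^ 2 := by positivity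
  calc (5 - β) / ((5 - β) ^ 2 + τ ^ 2) ≤ (5 - β) / ((3 / 2 - β) ^ 2 + τ ^ 2) := by
        apply div_le_div_of_nonneg_left (by linarith) hd1
        nlinarith
    _ ≤ (10 * (3 / 2 - β)) / ((3 / 2 - β) ^ 2 + τ ^ 2) := by
        apply div_le_div_of_nonneg_right _ hd1.le
        linarith
    _ = 10 * ((3 / 2 - β) / ((3 / 2 - β) ^ 2 + τ ^ 2)) := by ring

/-- RH-FREE comparison across abscissae: `Re ξ'/ξ(5+it) ≤ 10 · Re ξ'/ξ(3/2+it)` (termwise in the Hadamard sum, using only `0 < Re ρ < 1`). -/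
theorem re_logDeriv_riemannXi_five_le (t : ℝ) :
    (logDeriv riemannXi (((5 : ℝ) : ℂ) + (t : ℂ) * I)).re ≤
      10 * (logDeriv riemannXi (((3 / 2 : ℝ) : ℂ) + (t : ℂ) * I)).re := by
  obtain ⟨b, hb⟩ := exists_isHadamardSeq 0
  set s₁ : ℂ := ((3 / 2 : ℝ) : ℂ) + (t : ℂ) * I with hs₁
  set s₂ : ℂ := ((5 : ℝ) : ℂ) + (t : ℂ) * I with hs₂
  have h1re : s₁.re = 3 / 2 := by simp [hs₁]
  have h2re : s₂.re = 5 := by simp [hs₂]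
  have h1im : s₁.im = t := by simp [hs₁]
  have h2im : s₂.im = t := by simp [hs₂]
  have hξ₁ : riemannXi s₁ ≠ 0 := riemannXi_ne_zero_of_one_le_re (by rw [h1re]; norm_num)
  have hξ₂ : riemannXi s₂ ≠ 0 := riemannXi_ne_zero_of_one_le_re (by rw [h2re]; norm_num)
  have hS : ∀ {s : ℂ}, riemannXi s ≠ 0 → Summable fun n => if b n = 0 then (0 : ℝ) else
      (1 / (s - IsHadamardSeq.xiZero b n)).re + (1 / (s - (1 - IsHadamardSeq.xiZero b n))).re := by
    intro s hs
    refine (Complex.hasSum_re (hb.summable_pairs hs).hasSum).summable.congr fun n => ?_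
    split_ifs <;> simp
  rw [hb.re_logDeriv_riemannXi_eq_tsum hξ₁, hb.re_logDeriv_riemannXi_eq_tsum hξ₂, ← tsum_mul_left]
  refine Summable.tsum_le_tsum (fun n => ?_) (hS hξ₂) ((hS hξ₁).mul_left 10)
  split_ifs with hn
  · simp
  · obtain ⟨-, hβ0, hβ1⟩ := hb.riemannZeta_xiZero hn
    have e1 : (1 - IsHadamardSeq.xiZero b n).re = 1 - (IsHadamardSeq.xiZero b n).re := by simp
    have e2 : (1 - IsHadamardSeq.xiZero b n).im = -(IsHadamardSeq.xiZero b n).im := by simp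
    have hco : ∀ s ρ : ℂ, (1 / (s - ρ)).re = (s.re - ρ.re) / ((s.re - ρ.re) ^ 2 + (s.im - ρ.im) ^ 2) := by
      intro s ρ
      rw [IsHadamardSeq.re_inv_sub_eq, Complex.sq_norm, Complex.normSq_apply, sub_re, sub_im]
      ring
    simp only [hco, h1re, h2re, h1im, h2im, e1, e2, mul_add]
    exact add_le_add (hadamardTerm_compare hβ0 hβ1 _)
      (hadamardTerm_compare (by linarith) (by linarith) _)

/-- RH-FREE (tree model `norm_logDeriv_riemannXi_sub_model_le'`): for `|t| ≥ 5`, `Re ξ'/ξ(5 + it) ≥ ½ log(|t|/2Real.pi) − 1.3824`. -/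
theorem re_logDeriv_riemannXi_five_ge {t : ℝ} (ht : 5 ≤ |t|) :
    Real.log (|t| / (2 * Real.pi)) / 2 - 1.3824 ≤ (logDeriv riemannXi (((5 : ℝ) : ℂ) + (t : ℂ) * I)).re := by
  have key : ∀ T : ℝ, 5 ≤ T →
      Real.log (T / (2 * Real.pi)) / 2 - 1.3824 ≤ (logDeriv riemannXi (((5 : ℝ) : ℂ) + (T : ℂ) * I)).re := by
    intro T hT
    have hT0 : 0 < T := by linarith
    have h := norm_logDeriv_riemannXi_sub_model_le' (T := T) (v := 5) (V := 5) hT le_rfl le_rfl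
    have h1 : |(logDeriv riemannXi (((5 : ℝ) : ℂ) + (T : ℂ) * I) - xiLogDerivModel T).re| ≤
        0.0824 + 4 / T + 5 / (2 * T) := (Complex.abs_re_le_norm _).trans h
    rw [sub_re, xiLogDerivModel_re] at h1
    have h4 : 4 / T ≤ 4 / 5 := div_le_div_of_nonneg_left (by norm_num) (by norm_num) hT
    have h5 : 5 / (2 * T) ≤ 1 / 2 := by
      rw [div_le_iff₀ (by positivity)]; linarith
    have h6 := (abs_le.1 h1).1
    linarith
  rcases le_or_gt 0 t with ht0 | ht0
  · rw [abs_of_nonneg ht0] at ht ⊢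
    exact key t ht
  · have hta : |t| = -t := abs_of_neg ht0
    have hconj : ((5 : ℝ) : ℂ) + (t : ℂ) * I = conj ((((5 : ℝ) : ℂ) + ((|t| : ℝ) : ℂ) * I)) := by
      apply Complex.ext <;> simp [hta]
    rw [hconj, logDeriv_riemannXi_conj, Complex.conj_re]
    exact key |t| ht

/-- RH-FREE: for `|t| ≥ 5`, `Re ξ'/ξ(3/2 + it) ≥ (½ log(|t|/2Real.pi) − 1.3824)/10`. -/
theorem re_logDeriv_riemannXi_threeHalves_ge {t : ℝ} (ht : 5 ≤ |t|) :
    (Real.log (|t| / (2 * Real.pi)) / 2 - 1.3824) / 10 ≤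
      (logDeriv riemannXi (((3 / 2 : ℝ) : ℂ) + (t : ℂ) * I)).re := by
  have h1 := re_logDeriv_riemannXi_five_ge ht
  have h2 := re_logDeriv_riemannXi_five_le t
  rw [div_le_iff₀ (by norm_num : (0 : ℝ) < 10)]
  linarith

/-- `1/2 − i(u + i) = 3/2 − iu`. -/
theorem half_sub_I_mul_line (u : ℝ) :
    (1 : ℂ) / 2 - I * ((u : ℂ) + ((1 : ℝ) : ℂ) * I) = ((3 / 2 : ℝ) : ℂ) + ((-u : ℝ) : ℂ) * I := by
  push_cast
  linear_combination (-1 : ℂ) * I_mul_I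

/-- RH-FREE: `‖Θ_θ(u + i)‖ = exp(−2θ · Re ξ'/ξ(3/2 − iu))`. -/
theorem norm_limTheta_line_one (θ u : ℝ) :
    ‖limTheta θ ((u : ℂ) + ((1 : ℝ) : ℂ) * I)‖ =
      Real.exp (-2 * θ * (logDeriv riemannXi (((3 / 2 : ℝ) : ℂ) + ((-u : ℝ) : ℂ) * I)).re) := by
  -- `limTheta` here and `Literature.NumberTheory.LFunctions.limTheta` are the same term (`rfl`).
  have h : ‖limTheta θ ((u : ℂ) + ((1 : ℝ) : ℂ) * I)‖ =
      Real.exp (-2 * θ * (logDeriv riemannXi (1 / 2 - I * ((u : ℂ) + ((1 : ℝ) : ℂ) * I))).re) :=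
    Literature.NumberTheory.LFunctions.norm_limTheta θ _
  rw [h, half_sub_I_mul_line]

/-- `Re (3/2 - iu) = 3/2 ≥ 1`. -/
theorem one_le_re_threeHalves_line (u : ℝ) : 1 ≤ ((((3 / 2 : ℝ) : ℂ) + ((-u : ℝ) : ℂ) * I)).re := by
  simp only [add_re, ofReal_re, mul_re, ofReal_im, I_re, I_im]
  norm_num

/-- RH-FREE pointwise majorant on the line `Im z = 1`: `‖Θ_θ(u+i)‖ ≤ e^{θ(Real.pi+1)} (1+|u|)^{-θ/10}` (`θ ≥ 0`; crude constants). -/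
theorem norm_limTheta_line_one_le {θ : ℝ} (hθ : 0 ≤ θ) (u : ℝ) :
    ‖limTheta θ ((u : ℂ) + ((1 : ℝ) : ℂ) * I)‖ ≤
      Real.exp (θ * (Real.pi + 1)) * (1 + |u|) ^ (-(θ / 10)) := by
  have hu1 : 0 < 1 + |u| := by positivity
  rw [Real.rpow_def_of_pos hu1, ← Real.exp_add, norm_limTheta_line_one, Real.exp_le_exp]
  set R := (logDeriv riemannXi (((3 / 2 : ℝ) : ℂ) + ((-u : ℝ) : ℂ) * I)).re with hR
  have hR0 : 0 ≤ R :=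
    Summit.RiemannHypothesis.RiemannHypothesis.Cruxes.KernelSupport.Birth.re_logDeriv_riemannXi_nonneg
      (one_le_re_threeHalves_line u)
  have hθR : 0 ≤ θ * R := mul_nonneg hθ hR0
  have hθπ : θ * 3 ≤ θ * Real.pi := mul_le_mul_of_nonneg_left Real.pi_gt_three.le hθ
  have hlog1 : Real.log (1 + |u|) ≤ |u| := by
    have := Real.log_le_sub_one_of_pos hu1; linarith
  rcases le_or_gt |u| 5 with hu | hu
  · have h1 : θ * Real.log (1 + |u|) ≤ θ * 5 := mul_le_mul_of_nonneg_left (by linarith) hθ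
    linarith
  · have hu0 : 0 < |u| := by linarith
    have hdec := re_logDeriv_riemannXi_threeHalves_ge (t := -u) (by rw [abs_neg]; exact hu.le)
    rw [abs_neg] at hdec
    have hlog2 : Real.log (1 + |u|) ≤ Real.log |u| + 1 / 5 := by
      have e : 1 + |u| = |u| * (1 + 1 / |u|) := by field_simp; ring
      rw [e, Real.log_mul hu0.ne' (by positivity)]
      have h3 := Real.log_le_sub_one_of_pos (show (0 : ℝ) < 1 + 1 / |u| by positivity)
      have h15 : 1 / |u| ≤ 1 / 5 := one_div_le_one_div_of_le (by norm_num) hu.le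
      linarith
    have hlog3 : Real.log (|u| / (2 * Real.pi)) = Real.log |u| - Real.log (2 * Real.pi) :=
      Real.log_div hu0.ne' (by positivity)
    have hlog4 : Real.log (2 * Real.pi) ≤ 7 := by
      have := Real.log_le_sub_one_of_pos (show (0 : ℝ) < 2 * Real.pi by positivity)
      linarith [Real.pi_lt_four]
    have h3 : -2 * θ * R ≤ -2 * θ * ((Real.log (|u| / (2 * Real.pi)) / 2 - 1.3824) / 10) :=
      mul_le_mul_of_nonpos_left hdec (by linarith)
    rw [hlog3] at h3
    have h4 : θ * Real.log (1 + |u|) ≤ θ * (Real.log |u| + 1 / 5) :=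
      mul_le_mul_of_nonneg_left hlog2 hθ
    have h5 : θ * Real.log (2 * Real.pi) ≤ θ * 7 := mul_le_mul_of_nonneg_left hlog4 hθ
    linarith

/-- Continuity of `u ↦ Θ_θ(u + i)` (RH-FREE: `ξ ≠ 0` on `Re s = 3/2`). -/
theorem continuous_limTheta_line_one (θ : ℝ) :
    Continuous fun u : ℝ => limTheta θ ((u : ℂ) + ((1 : ℝ) : ℂ) * I) := by
  have hL : Continuous fun u : ℝ => logDeriv riemannXi (((3 / 2 : ℝ) : ℂ) + ((-u : ℝ) : ℂ) * I) :=
    (continuous_logDeriv_riemannXi_vertical (c := 3 / 2) (by norm_num)).comp continuous_neg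
  have : (fun u : ℝ => limTheta θ ((u : ℂ) + ((1 : ℝ) : ℂ) * I)) =
      fun u : ℝ => Complex.exp (-2 * θ *
        logDeriv riemannXi (((3 / 2 : ℝ) : ℂ) + ((-u : ℝ) : ℂ) * I)) := by
    funext u
    simp only [limTheta, half_sub_I_mul_line, logDeriv_apply]
  rw [this]
  exact (continuous_const.mul hL).cexp

/-- **K1 for `θ > 10` (RH-FREE).** `Θ_θ(· + i) ∈ L¹(ℝ)`: the majorant `e^{θ(π+1)}(1+|u|)^{-θ/10}` is integrable (`integrable_one_add_norm`, `finrank ℝ ℝ = 1 <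
θ/10`). -/
theorem integrable_limTheta_line_one_of_gt_ten {θ : ℝ} (hθ : 10 < θ) :
    Integrable (fun u : ℝ => limTheta θ ((u : ℂ) + ((1 : ℝ) : ℂ) * I)) := by
  have hmaj : Integrable (fun u : ℝ => Real.exp (θ * (Real.pi + 1)) * (1 + ‖u‖) ^ (-(θ / 10))) :=
    (integrable_one_add_norm (E := ℝ) (μ := volume) (r := θ / 10)
      (by simp; linarith)).const_mul (Real.exp (θ * (Real.pi + 1)))
  refine hmaj.mono' (continuous_limTheta_line_one θ).aestronglyMeasurable
    (Filter.Eventually.of_forall fun u => ?_)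
  simpa [Real.norm_eq_abs] using norm_limTheta_line_one_le (by linarith : 0 ≤ θ) u

/-- RH-detecting direction with K1 discharged for `θ > 10`: modulo K3 (vanishing of `K_θ` on the negatives) and K4 (Laplace identity on `Im z > 1`), `W_θ ∈ L²
⟹  RH`. RH-FREE implication about an RH-EQUIVALENT·DERIVED criterion; nothing here bears on the truth of RH. -/
theorem rh_of_limTemperedWitness_of_K34 {θ : ℝ} (hθ : 10 < θ)
    (h0 : ∀ x < 0, limKernel θ x = 0)
    (hLap : ∀ z : ℂ, 1 < z.im →
      IntegrableOn (fun x : ℝ => (limKernel θ x : ℂ) * Complex.exp (I * z * (x : ℂ))) (Set.Ioi 0) ∧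
        ∫ x in Set.Ioi (0 : ℝ), (limKernel θ x : ℂ) * Complex.exp (I * z * (x : ℂ)) = limTheta θ z)
    (hW : MemLp (limWindowAvg θ) 2 volume) : _root_.RiemannHypothesis :=
  rh_of_limTemperedWitness_of_K134 (by linarith : θ ≠ 0) (integrable_limTheta_line_one_of_gt_ten hθ)
    h0 hLap hW

end Summit.RiemannHypothesis.RiemannHypothesis.Theorems.SuzukiDoor

namespace Summit.RiemannHypothesis.RiemannHypothesis.Theorems

open Literature.NumberTheory.LFunctions

/-- **Route `DeBrangesSuzukiDoor`, support item `DoorModuloKernel` (stmt-RiemannHypothesis-19729) — PROVED.** For every `θ > 10`: if Suzuki's single kernel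
`K_θ` vanishes on `(-∞,0)` (K3) and satisfies the absolutely convergent Laplace identity `∫_0^∞ K_θ(x)e^{izx}dx = Θ_θ(z)` on `Im z > 1` (K4), then
square-integrability of the ONE explicit window function `W_θ(x) = ∫_0^1 K_θ(x+y)dy` implies the Riemann Hypothesis (H1 Laplace quotient + H2 symbol rigidity
+ K1/K2 regularity, all RH-FREE; port of the cell's scratch `rh_of_limTemperedWitness_of_K34`). RH-FREE theorem ABOUT an RH-EQUIVALENT·DERIVED criterion — it
does not assert that `W_θ ∈ L²`; nothing here bears on the truth of RH. -/
theorem doorModuloKernel_proof : Theses.DeBrangesSuzukiDoor.DoorModuloKernel := by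
  intro θ hθ Θ K h0 hLap hW
  exact SuzukiDoor.rh_of_limTemperedWitness_of_K34 hθ h0 hLap hW

end Summit.RiemannHypothesis.RiemannHypothesis.Theorems

end
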